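import Summits.Schanuel.Schanuel.Theorems.RootDecomp1KDescent03

/-!
# RootDecomp1KDescent — lens 1, generation 58, NODE 19 «DESCENT ON THE K-LINE» (Chevalley–Weil 2-descent to an étale double cover, then 2-adic Runge on the cover; RULE K-R49 (iii) payable clause; CLAIM L2723, PRICE L2727, K-R50) — continuation (RootDecomp1KDescent04): §9 THE ENGINE levelFinite_of_descentCert

(lens-1 g58 NODE 19 HOME kernel K = HOME/decomp-schanuel-lens-1/g58/Descent.lean 92ee3617…, 1568 l, 121 thm + 32 defs/structures (structure DescentCert, structure EisQ), imports tree …RootDecomp1KRunge06 ONLY = the port of node 18 (no Literature import, no fact def, no private, no set_option, no axiom / instance / sorry / native_decide); Probe / Ctrl0 / Ctrl (56 planted controls, ctrl_table19.txt) + NODE-g58.md + cert58.json/.txt + SHA256SUMS (34 files); CLAIM L2723, writer CHECK NOTE L2724/L2725 (certificate arithmetic reproduced at 13 values of λ), crit g10 EX-ANTE PRICE L2727 (ONE THEOREM ×1 for (A) engine + (B) the class DJ(3^j) + (C) territory JOINTLY iff CHECKLIST K-g58 (1)–(10); RULE K-R50 pre-announced; node-18 label erratum), census LIVENESS-v10 L2733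 (keys k2 / desc2; DJ rows; of record L2735), NODE L2743, critic VERDICT L2746 (crit g10): CLEARED — THEOREM ×1 for (A) engine + (B) the class {DJ 3^j} + (C) territory JOINTLY under RULE K-R49 (iii) («an infinite class of K-R49-territory pairs made unconditional», currency LevelFinite — strictly stronger than the residual ThinFibreAt 2), checklist K-g58 (1)–(10) met, rung 0; labels of record: VARIANT of a KNOWN TOOL (Levin 2008 §3 Thm 6 «Coverings and Runge's method» [corpus:paper:arxiv-0805.1345 p.7]) · PROBLEM-RELATIVE NEW (first descent on the K-line; first members outside every Runge-certifiable class; first LevelFinite for a positive-genus non-uniformised member); RULE K-R50 FIXED (toolkit of record ∪= 2-DESCENT via ℚ-rational 2-torsion of the Jacobian — for k = 2 a factorisation of Δ_x = c₁² − 4c₀c₂ over ℚ, in particular the square type −4·A·B with A + B = c₂ — twists killed by congruences / supports, then any toolkit step upstairs, every further such member / family / presentation / cover degree 2^r / Eisenstein prime / the abstract Descent2At engine ×0-as-record; OPEN TERRITORY at m₀ = 2 := K-R49 territory ∧ Jac has NO ℚ-rational 2-torsion datum — for k = 2 certified by «Δ_x ℚ-irreducible of degree ≡ 2 (mod 4)»;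 standing witness W4 (census TM33); UNCONDITIONAL PART ∪= {DJ 3^j} at the currency LevelFinite); PORT GO exactly as census STAGING NOTE 9 L2744 (agreed by the lens L2745) with the edits (a) + (b) SANCTIONED. Port by census-1 gen 23 as `RootDecomp1KDescent01–06` (`--supports stmt-Schanuel-33364`; no census credit): 01 = §0 small facts, §1 the curves `dsP Q A = x²·Q(Y) + (2x+1)·A(Y)` (`dsC`, `bev_dsP`), §2 the level equation in integers, §3 the Eisenstein form of `F_Q` (`structure EisQ`) and the homogenised `Y⁶`-identity, §4 THE DESCENT LEMMA (`twist_mod_eight`, `twist_support`, `twist_kill`, `twist_le`, **`descent`**); 02 = §5 the 2-adic Runge step on the double cover (`exists_sign_small`, ultrametric bookkeeping in ℂ₂), §6 `structure DescentCert Q A` (integral data + identities only) and the integer `dsI`; 03 = §7 the lift of a level point to the cover read in ℂ₂ (‖I‖₂ ≤ (2/‖D‖₂)·2^{−3·N!} for one sign), §8 the norm `dsNu`, the archimedean size of `I`, the endgame (`endgame_ds`, cost 5 < 6 = 2μ); 04 = §9 THE ENGINE **`levelFinite_of_descentCert : DescentCert Q A → LevelFinite (dsP Q A)`** and `thinFibreAt_of_descentCert`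 (every m₀); 05 = §10 THE FAMILY `DJ λ` (`djQ = Y⁴+3Y³+3Y²+3`, `djA`, `DJ`), ONE certificate `djCert j` polynomial in λ = 3^j, **`levelFinite_DJ : ∀ j, LevelFinite (DJ (3^j))`**, **`thinFibreAt_DJ : ∀ j m₀, ThinFibreAt m₀ (DJ (3^j))`** HYPOTHESIS-FREE, `DJ_injective`, named members `DJ1` `DJ3` `DJ9`; 06 = §11 TERRITORY (section Territory) by tree names: `isEisensteinAt_djQ`, irreducibility of the top over ℚ, **`DJ_territory`**, the named members' territory. PORT EDITS: (a) 16 one-line docstrings quoting the signature on the undocumented decls (`dsC_two` / `dsC_one` / `dsC_zero` / `dsC_of_gt`, `natDegree_djA_le`, `natDegree_djT_le`, `natDegree_djF0_le` … `natDegree_djF3_le`, `levelFinite_DJ1/3/9`, `thinFibreAt_two_DJ1/3/9`); (b) PRIVATISATION ×5 of one-liners that the head dry-run flagged as near-duplicates of foreign / out-of-cone declarations — `odd_three_pow` (≡ a Crystal3D decl), `norm_intCast_le_one_ds` (≡ a BirchSwinnertonDyer decl; tree-private twins in Runge01 / LocalExponent01), `eight_dvd_sq_sub_one_ds` (≡ a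 HodgeConjecture decl), `isCoprime_num_den_ds` (≡ `Literature.NumberTheory.DiophantineApproximation.isCoprime_num_den`, not in the import cone), `odd_psNumer_ds` (≡ `RootDecomp1KCollarCell.odd_psNumer_two`, same summit but outside the cone — importing CollarCell02 would add 53 modules) — with file-local private copies re-emitted where a later part uses them (03: `norm_intCast_le_one_ds`, `odd_three_pow`; 04: `isCoprime_num_den_ds`, `odd_psNumer_ds`; 05: `odd_three_pow`); nothing else (no deletion, no replacement, no import added, no set_option; K's three `@[simp]` kept); provenance doc blocks + continuation headers = K's own open-lines; statements and proofs VERBATIM. Rung 0 — nothing here proves Schanuel, 33364, 33363, 31077 or ThinFibre 2; everything HYPOTHESIS-FREE.)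
-/

noncomputable section

namespace Summit.Schanuel.Schanuel.Theorems.RootDecomp1KDescent

open Polynomial LiouvilleNumber
open scoped Nat
open Summit.Schanuel.Schanuel.Theorems.RootDecomp1KTwoBaseCell (psNumer partialSum_eq_psNumer_div coprime_psNumer)
open Summit.Schanuel.Schanuel.Theorems.RootDecomp1KRelLiouvilleCell (partialSum_two_strictMono)
open Summit.Schanuel.Schanuel.Theorems.RootDecomp1KDegreeLadder
open Summit.Schanuel.Schanuel.Theorems.RootDecomp1KXLinear
open Summit.Schanuel.Schanuel.Theorems.RootDecomp1KXLinearII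
open Summit.Schanuel.Schanuel.Theorems.RootDecomp1KXTop
open Summit.Schanuel.Schanuel.Theorems.RootDecomp1KXAll
open Summit.Schanuel.Schanuel.Theorems.RootDecomp1KLevelFinite
open Summit.Schanuel.Schanuel.Theorems.RootDecomp1KThueMahler
open Summit.Schanuel.Schanuel.Theorems.RootDecomp1KParamThueMahler
open Summit.Schanuel.Schanuel.Theorems.RootDecomp1KLocalExponent
open Summit.Schanuel.Schanuel.Theorems.RootDecomp1KRunge

/-- `num r ⊥ den r`. -/
private theorem isCoprime_num_den_ds (r : ℚ) : IsCoprime r.num (r.den : ℤ) := by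
  rw [Int.isCoprime_iff_gcd_eq_one]
  have := r.reduced
  simpa [Int.gcd] using this

/-- `p_N` is odd (`N ≥ 2`). -/
private theorem odd_psNumer_ds {N : ℕ} (hN : 2 ≤ N) : Odd ((psNumer 2 N : ℕ) : ℤ) := by
  have h := coprime_psNumer 2 hN
  have h2 : ¬ 2 ∣ psNumer 2 N := by
    intro hd
    have := Nat.Coprime.eq_one_of_dvd (Nat.Coprime.symm h) hd
    omega
  rw [Int.odd_iff]
  omega

/-! ### §9 THE ENGINE: `LevelFinite` (hence `ThinFibreAt m₀` for every `m₀`) from a descent certificate -/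

/-- archimedean size of the lifted coordinates: `|σgp| ≤ 2λq`, `|σg(p+q)| ≤ 3λq` (`p < 2q`, `g ≤ λ`). -/
theorem abs_lift_le_ds {p q g l σ : ℤ} (hp0 : 0 < p) (hq0 : 0 < q) (hg0 : 0 < g) (hgl : g ≤ l) (hpq : p < 2 * q)
    (hσ : σ = 1 ∨ σ = -1) :
    |((σ * (g * p) : ℤ) : ℝ)| ≤ 2 * (l : ℝ) * q ∧ |((σ * (g * (p + q)) : ℤ) : ℝ)| ≤ 3 * (l : ℝ) * q := by
  have hp0R : (0 : ℝ) < p := by exact_mod_cast hp0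
  have hq0R : (0 : ℝ) < q := by exact_mod_cast hq0
  have hg0R : (0 : ℝ) < g := by exact_mod_cast hg0
  have hglR : (g : ℝ) ≤ l := by exact_mod_cast hgl
  have hpqR : (p : ℝ) < 2 * q := by exact_mod_cast hpq
  have hl0 : (0 : ℝ) ≤ l := hg0R.le.trans hglR
  have hσR : |((σ : ℤ) : ℝ)| = 1 := by rcases hσ with rfl | rfl <;> simp
  have e1 : (((σ * (g * p) : ℤ)) : ℝ) = ((σ : ℤ) : ℝ) * ((g : ℝ) * p) := by push_cast; ring
  have e2 : (((σ * (g * (p + q)) : ℤ)) : ℝ) = ((σ : ℤ) : ℝ) * ((g : ℝ) * (p + q)) := by push_cast; ring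
  rw [e1, e2, abs_mul, hσR, one_mul, abs_mul ((σ : ℤ) : ℝ), hσR, one_mul, abs_of_pos (mul_pos hg0R hp0R),
    abs_of_pos (mul_pos hg0R (by linarith))]
  constructor
  · calc (g : ℝ) * p ≤ l * (2 * q) := mul_le_mul hglR hpqR.le hp0R.le hl0
      _ = 2 * (l : ℝ) * q := by ring
  · calc (g : ℝ) * (p + q) ≤ l * (3 * q) := mul_le_mul hglR (by linarith) (by linarith) hl0
      _ = 3 * (l : ℝ) * q := by ring

/-- the denominator bound `den(r)² ≤ K₃·q` from the archimedean floor `c₀ ≤ |B(r)|`, `den⁴·B(r) = Z₂²` and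
`|Z₂| ≤ 3λq`. -/
theorem den_sq_le_ds {d c₀ Br Z K₃ L q : ℝ} (hd : 0 < d) (hc₀ : 0 < c₀) (hB : c₀ ≤ |Br|) (hBr : d ^ 4 * Br = Z ^ 2)
    (hZ : |Z| ≤ 3 * L * q) (hK : 9 * L ^ 2 / c₀ ≤ K₃) (hK1 : 1 ≤ K₃) (hq : 0 ≤ q) :
    d ^ 2 ≤ K₃ * q := by
  have hBr0 : 0 ≤ Br := (mul_nonneg_iff_of_pos_left (pow_pos hd 4)).mp (hBr ▸ sq_nonneg Z)
  have h4 : d ^ 4 * c₀ ≤ 9 * L ^ 2 * q ^ 2 := by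
    calc d ^ 4 * c₀ ≤ d ^ 4 * |Br| := mul_le_mul_of_nonneg_left hB (by positivity)
      _ = Z ^ 2 := by rw [abs_of_nonneg hBr0, hBr]
      _ = |Z| ^ 2 := (sq_abs Z).symm
      _ ≤ (3 * L * q) ^ 2 := pow_le_pow_left₀ (abs_nonneg Z) hZ 2
      _ = 9 * L ^ 2 * q ^ 2 := by ring
  have h5 : (d ^ 2) ^ 2 ≤ (K₃ * q) ^ 2 := by
    have hK3sq : K₃ ≤ K₃ ^ 2 := by nlinarith
    calc (d ^ 2) ^ 2 = d ^ 4 * c₀ / c₀ := by rw [mul_div_assoc, div_self hc₀.ne', mul_one]; ring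
      _ ≤ 9 * L ^ 2 * q ^ 2 / c₀ := div_le_div_of_nonneg_right h4 hc₀.le
      _ = (9 * L ^ 2 / c₀) * q ^ 2 := by ring
      _ ≤ K₃ * q ^ 2 := mul_le_mul_of_nonneg_right hK (sq_nonneg q)
      _ ≤ K₃ ^ 2 * q ^ 2 := mul_le_mul_of_nonneg_right hK3sq (sq_nonneg q)
      _ = (K₃ * q) ^ 2 := by ring
  have hKq : 0 ≤ K₃ * q := mul_nonneg (zero_le_one.trans hK1) hq
  exact (pow_le_pow_iff_left₀ (sq_nonneg d) hKq (by norm_num : (2 : ℕ) ≠ 0)).mp h5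

/-- `|A(r)| ≤ |B(r)|` at a lifted point: `den⁴·A(r) = −Z₁²`, `den⁴·B(r) = Z₂²`, `|Z₁| ≤ |Z₂|`. -/
theorem abs_A_le_abs_B_ds {d Ar Br Z₁ Z₂ : ℝ} (hd : 0 < d) (hA : d ^ 4 * Ar = -Z₁ ^ 2) (hB : d ^ 4 * Br = Z₂ ^ 2)
    (hZ : |Z₁| ≤ |Z₂|) : |Ar| ≤ 1 * |Br| := by
  rw [one_mul]
  refine le_of_mul_le_mul_left ?_ (pow_pos hd 4)
  rw [← abs_of_pos (pow_pos hd 4), ← abs_mul, ← abs_mul, hA, hB, abs_neg, abs_pow, abs_pow]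
  exact pow_le_pow_left₀ (abs_nonneg _) hZ 2

/-- `I = D²·(d⁵f₀ + d³f₁z₁ + d³f₂z₂ + d·f₃z₁z₂) = 0` with `D, d ≠ 0` is `Φ(r, z₁/d², z₂/d²) = 0`. -/
theorem phi_zero_of_I_zero_ds {D d f0 f1 f2 f3 z₁ z₂ : ℚ} (hD : D ≠ 0) (hd : d ≠ 0)
    (h : D ^ 2 * (d ^ 5 * f0 + d ^ 3 * f1 * z₁ + d ^ 3 * f2 * z₂ + d ^ 1 * f3 * (z₁ * z₂)) = 0) :
    f0 + f1 * (z₁ / d ^ 2) + f2 * (z₂ / d ^ 2) + f3 * ((z₁ / d ^ 2) * (z₂ / d ^ 2)) = 0 := by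
  have h' : d ^ 5 * f0 + d ^ 3 * f1 * z₁ + d ^ 3 * f2 * z₂ + d ^ 1 * f3 * (z₁ * z₂) = 0 :=
    (mul_eq_zero.mp h).resolve_left (pow_ne_zero 2 hD)
  have hd5 : d ^ 5 ≠ 0 := pow_ne_zero 5 hd
  have : f0 + f1 * (z₁ / d ^ 2) + f2 * (z₂ / d ^ 2) + f3 * ((z₁ / d ^ 2) * (z₂ / d ^ 2)) =
      (d ^ 5 * f0 + d ^ 3 * f1 * z₁ + d ^ 3 * f2 * z₂ + d ^ 1 * f3 * (z₁ * z₂)) / d ^ 5 := by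
    rw [eq_div_iff hd5]; field_simp
  rw [this]
  exact div_eq_zero_iff.mpr (Or.inl h')

/-- the square of a lifted coordinate: `den⁴·A(r) = ∓Z²`, `σ² = 1` give `(σZ/den²)² = ∓A(r)`. -/
theorem sq_lift_ds {d Ar Z σ s : ℚ} (hd : d ≠ 0) (hσ : σ ^ 2 = 1) (hs : s * s = 1)
    (hA : d ^ 4 * Ar = s * Z ^ 2) : (σ * Z / d ^ 2) ^ 2 = s * Ar := by
  rw [div_pow, mul_pow, hσ, one_mul, ← pow_mul, div_eq_iff (pow_ne_zero _ hd), show 2 * 2 = 4 by rfl]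
  linear_combination (-s) * hA - Z ^ 2 * hs

/-- THE CORE OF THE ENGINE.  Above an explicit `N₀(C)`, every level point `(s_N, r)` of `Q·x² + A·(2x+1)` with
`|r| ≤ C` has `ν(r) = 0`: DESCENT (`descent`) lifts it to the double cover with `z₁ = σgp`, `z₂ = σg(p+q)`;
the 2-adic Runge step (`exists_sign_small`) gives `‖I‖₂ ≤ (2/‖D‖₂)·2^{−3N!}`; the archimedean floor
(`exists_arch_floor`, from the Bezout identity) gives `den(r)² ≤ K₃·2^{N!}` and `|I| ≤ K₄·den(r)·4^{N!}`;
the product formula (`two_pow_le_of_norm_le`) and `5 < 6` (`endgame_ds`) force `I = 0`, i.e. `Φ = 0` at the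
lifted point, whence `ν(r) = Norm Φ (r) = 0` (`nu_eq_zero_of_phi`). -/
theorem nu_root_of_level {Q A : ℤ[X]} (𝒞 : DescentCert Q A) (C : ℝ) :
    ∃ N₀ : ℕ, ∀ N : ℕ, N₀ ≤ N → ∀ r : ℚ, |(r : ℝ)| ≤ C → bev (dsP Q A) (partialSum 2 N) r = 0 →
      aeval r (dsNu Q A 𝒞.F0 𝒞.F1 𝒞.F2 𝒞.F3) = 0 := by
  classical
  -- the constants of the window `C`
  have hl0 : (0 : ℤ) < (3 : ℤ) ^ 𝒞.j := by positivity
  set L : ℝ := (((3 : ℤ) ^ 𝒞.j : ℤ) : ℝ) with hL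
  have hL0 : 0 < L := by rw [hL]; exact_mod_cast hl0
  have hcopQ := isCoprime_of_bezout 𝒞.hbez 𝒞.hm
  obtain ⟨c₀, hc₀, hfloor⟩ := exists_arch_floor A (Q - A) hcopQ C 1
  obtain ⟨M0, -, hM0⟩ := exists_abs_aeval_le 𝒞.F0 C
  obtain ⟨M1, -, hM1⟩ := exists_abs_aeval_le 𝒞.F1 C
  obtain ⟨M2, -, hM2⟩ := exists_abs_aeval_le 𝒞.F2 C
  obtain ⟨M3, -, hM3⟩ := exists_abs_aeval_le 𝒞.F3 C
  set K₃ : ℝ := max 1 (9 * L ^ 2 / c₀) with hK₃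
  have hK₃1 : 1 ≤ K₃ := le_max_left _ _
  have hK₃2 : 9 * L ^ 2 / c₀ ≤ K₃ := le_max_right _ _
  set K₄ : ℝ := (𝒞.D : ℝ) ^ 2 * (M0 * K₃ ^ 2 + 2 * L * M1 * K₃ + 3 * L * M2 * K₃ + 6 * L ^ 2 * M3) with hK₄
  have hDn : 0 < ‖(𝒞.D : PadicAlgCl 2)‖ := norm_intCast_pos_ds 𝒞.hD
  set KD : ℝ := 2 / ‖(𝒞.D : PadicAlgCl 2)‖ with hKD
  obtain ⟨n₁, hn₁⟩ := exists_pow_lt_of_lt_one (half_pos hDn) (by norm_num : (1 / 2 : ℝ) < 1)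
  obtain ⟨n₂, hn₂⟩ := pow_unbounded_of_one_lt (KD ^ 2 * K₄ ^ 2 * K₃) (by norm_num : (1 : ℝ) < 2)
  refine ⟨max 3 (max n₁ n₂), fun N hN r hrC hlev0 => ?_⟩
  have hN3 : 3 ≤ N := le_trans (le_max_left _ _) hN
  have hNn₁ : n₁ ≤ N := le_trans (le_trans (le_max_left _ _) (le_max_right _ _)) hN
  have hNn₂ : n₂ ≤ N := le_trans (le_trans (le_max_right _ _) (le_max_right _ _)) hN
  have hNf : N ≤ N ! := Nat.self_le_factorial N
  -- THE DESCENT (with `p := p_N`, `q := 2^{N!}` generalised)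
  obtain ⟨p, hp⟩ : ∃ p : ℤ, ((psNumer 2 N : ℕ) : ℤ) = p := ⟨_, rfl⟩
  obtain ⟨q, hq⟩ : ∃ q : ℤ, (2 : ℤ) ^ N ! = q := ⟨_, rfl⟩
  have hp0 : 0 < p := by rw [← hp]; exact_mod_cast psNumer_pos_runge N
  have hq0 : 0 < q := by rw [← hq]; positivity
  have hpq : p < 2 * q := by rw [← hp, ← hq]; exact_mod_cast psNumer_lt N
  have hpodd : Odd p := by rw [← hp]; exact odd_psNumer_ds (by omega)
  have hQdeg : Q.natDegree ≤ 4 := 𝒞.eis.deg.le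
  have hAdeg : A.natDegree ≤ 4 := 𝒞.hA.trans (by norm_num)
  have hlev := level_eq_int hQdeg hAdeg hlev0
  rw [hp, hq] at hlev
  obtain ⟨g, hg0, hgl, hFA, hFQ, hu, hd⟩ := descent (e := N !) (j := 𝒞.j) (FT := hf 𝒞.T 2 r) hq.symm
    (le_trans hN3 hNf) rfl hpodd hp0 (isCoprime_num_den_ds r) (hf_Q_expand 𝒞.eis r)
    𝒞.eis.c1 hlev (hom_identity hQdeg hAdeg 𝒞.hTdeg 𝒞.hT r)
  have hgl' : g ≤ (3 : ℤ) ^ 𝒞.j := Int.le_of_dvd hl0 hgl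
  -- THE 2-ADIC SIDE
  have hε : 2 * (1 / 2 : ℝ) ^ N ! < ‖(𝒞.D : PadicAlgCl 2)‖ := by
    have h1 : (1 / 2 : ℝ) ^ N ! ≤ (1 / 2) ^ n₁ :=
      pow_le_pow_of_le_one (by norm_num) (by norm_num) (hNn₁.trans hNf)
    linarith
  obtain ⟨σ, hσ, hnorm⟩ := exists_sign_small 𝒞 hu hd (by rw [hp]; exact hFA) (by rw [hp, hq]; exact hFQ) hε
  rw [hp, hq] at hnorm
  have hpf : dsI 𝒞.F0 𝒞.F1 𝒞.F2 𝒞.F3 𝒞.D r (σ * (g * p)) (σ * (g * (p + q))) ≠ 0 →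
      ((2 : ℝ) ^ N !) ^ 3 ≤ KD * |(dsI 𝒞.F0 𝒞.F1 𝒞.F2 𝒞.F3 𝒞.D r (σ * (g * p)) (σ * (g * (p + q))) : ℝ)| :=
    fun h0 => by
    have := two_pow_le_of_norm_le h0 (K := KD) (m := 3 * N !) (by rw [hKD]; exact hnorm)
    rwa [pow_mul'] at this
  -- THE ARCHIMEDEAN SIDE
  have hqR : ((q : ℤ) : ℝ) = (2 : ℝ) ^ N ! := by rw [← hq]; push_cast; ring
  obtain ⟨hz1, hz2⟩ := abs_lift_le_ds hp0 hq0 hg0 hgl' hpq hσ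
  rw [hqR] at hz1 hz2
  have hd0R : (0 : ℝ) < (r.den : ℝ) := by exact_mod_cast r.pos
  have hAr : (r.den : ℝ) ^ 4 * aeval (r : ℝ) A = -(((g * p : ℤ) : ℝ)) ^ 2 := by
    rw [← hf_cast_real hAdeg, hFA]; push_cast; ring
  have hBr : (r.den : ℝ) ^ 4 * aeval (r : ℝ) (Q - A) = (((g * (p + q) : ℤ) : ℝ)) ^ 2 := by
    rw [map_sub, mul_sub, ← hf_cast_real hAdeg, ← hf_cast_real hQdeg, hFQ, hFA]; push_cast; ring
  have hZ : |(((g * p : ℤ) : ℝ))| ≤ |(((g * (p + q) : ℤ) : ℝ))| := by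
    have h1 : (0 : ℝ) ≤ ((g * p : ℤ) : ℝ) := by exact_mod_cast (mul_pos hg0 hp0).le
    have h2 : ((g * p : ℤ) : ℝ) ≤ ((g * (p + q) : ℤ) : ℝ) := by
      exact_mod_cast mul_le_mul_of_nonneg_left (le_add_of_nonneg_right hq0.le) hg0.le
    rw [abs_of_nonneg h1, abs_of_nonneg (h1.trans h2)]; exact h2
  have hc₀B : c₀ ≤ |aeval (r : ℝ) (Q - A)| := hfloor _ hrC (abs_A_le_abs_B_ds hd0R hAr hBr hZ)
  have hz2' : |(((g * (p + q) : ℤ) : ℝ))| ≤ 3 * L * (2 : ℝ) ^ N ! := by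
    have : |((σ * (g * (p + q)) : ℤ) : ℝ)| = |(((g * (p + q) : ℤ) : ℝ))| := by
      push_cast; rw [abs_mul (σ : ℝ), show |((σ : ℤ) : ℝ)| = 1 by rcases hσ with rfl | rfl <;> simp, one_mul]
    rw [← this]; exact hz2
  have hd2 : (r.den : ℝ) ^ 2 ≤ K₃ * (2 : ℝ) ^ N ! :=
    den_sq_le_ds hd0R hc₀ hc₀B hBr hz2' hK₃2 hK₃1 (by positivity)
  have habs := abs_dsI_le 𝒞.hF0 𝒞.hF1 𝒞.hF2 𝒞.hF3 hM0 hM1 hM2 hM3 𝒞.D hrC hL0.le (by positivity) hz1 hz2 hd2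
  -- THE ENDGAME: `I = 0`
  have hbig : KD ^ 2 * K₄ ^ 2 * K₃ < (2 : ℝ) ^ N ! :=
    lt_of_lt_of_le hn₂ (pow_le_pow_right₀ one_le_two (hNn₂.trans hNf))
  have hI0 := endgame_ds (by positivity) hpf habs hd2 hbig
  -- `Φ = 0` at the lifted point, read in `ℚ`, and `ν(r) = 0`
  have hD0 : (𝒞.D : ℚ) ≠ 0 := by exact_mod_cast 𝒞.hD
  have hd0 : (r.den : ℚ) ≠ 0 := by exact_mod_cast r.den_nz
  have hσ2 : ((σ : ℤ) : ℚ) ^ 2 = 1 := by rcases hσ with rfl | rfl <;> norm_num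
  have hJ : (𝒞.D : ℚ) ^ 2 * ((r.den : ℚ) ^ 5 * aeval r 𝒞.F0 + (r.den : ℚ) ^ 3 * aeval r 𝒞.F1 * ((σ * (g * p) : ℤ) : ℚ)
      + (r.den : ℚ) ^ 3 * aeval r 𝒞.F2 * ((σ * (g * (p + q)) : ℤ) : ℚ)
      + (r.den : ℚ) ^ 1 * aeval r 𝒞.F3 * (((σ * (g * p) : ℤ) : ℚ) * ((σ * (g * (p + q)) : ℤ) : ℚ))) = 0 := by
    have := congrArg (fun t : ℤ => (t : ℚ)) hI0
    simp only [dsI, Int.cast_mul, Int.cast_add, Int.cast_pow, Int.cast_zero, hf_cast 𝒞.hF0, hf_cast 𝒞.hF1,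
      hf_cast 𝒞.hF2, hf_cast 𝒞.hF3] at this
    push_cast
    linear_combination this
  have hΦ := phi_zero_of_I_zero_ds hD0 hd0 hJ
  have hAq : (r.den : ℚ) ^ 4 * aeval r A = (-1) * (((g * p : ℤ) : ℚ)) ^ 2 := by
    rw [← hf_cast hAdeg, hFA]; push_cast; ring
  have hBq : (r.den : ℚ) ^ 4 * aeval r (Q - A) = 1 * (((g * (p + q) : ℤ) : ℚ)) ^ 2 := by
    rw [map_sub, mul_sub, ← hf_cast hAdeg, ← hf_cast hQdeg, hFQ, hFA]; push_cast; ring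
  have h1 := sq_lift_ds hd0 hσ2 (by norm_num) hAq
  have h2 := sq_lift_ds hd0 hσ2 (by norm_num) hBq
  rw [neg_one_mul] at h1
  rw [one_mul] at h2
  have e1 : (((σ * (g * p) : ℤ) : ℚ)) / (r.den : ℚ) ^ 2 = ((σ : ℤ) : ℚ) * (((g * p : ℤ) : ℚ)) / (r.den : ℚ) ^ 2 := by
    push_cast; ring
  have e2 : (((σ * (g * (p + q)) : ℤ) : ℚ)) / (r.den : ℚ) ^ 2 =
      ((σ : ℤ) : ℚ) * (((g * (p + q) : ℤ) : ℚ)) / (r.den : ℚ) ^ 2 := by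
    push_cast; ring
  rw [e1, e2] at hΦ
  rw [aeval_dsNu]
  exact nu_eq_zero_of_phi h1 h2 hΦ

/-- **THE ENGINE.**  A descent certificate for `(Q, A)` makes `LevelFinite (Q·x² + A·(2x+1))` UNCONDITIONAL:
above `N₀(C)` the level points have `ν(r) = 0` (`nu_root_of_level`), `ν ≠ 0` has finitely many rational roots,
and each non-degenerate `r` lies on finitely many levels (`levels_finite_of_nondeg`, tree). -/
theorem levelFinite_of_descentCert {Q A : ℤ[X]} (𝒞 : DescentCert Q A) : LevelFinite (dsP Q A) := by
  classical
  intro C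
  obtain ⟨N₀, hN₀⟩ := nu_root_of_level 𝒞 C
  set R : Set ℚ := {r : ℚ | aeval r (dsNu Q A 𝒞.F0 𝒞.F1 𝒞.F2 𝒞.F3) = 0 ∧ ∃ x : ℝ, bev (dsP Q A) x r ≠ 0}
    with hR
  have hRfin : R.Finite := (roots_finite_ds _ 𝒞.hnu).subset fun r hr => hr.1
  have hU : (⋃ r ∈ R, {N : ℕ | bev (dsP Q A) (partialSum 2 N) r = 0}).Finite :=
    hRfin.biUnion fun r hr => levels_finite_of_nondeg _ r hr.2
  refine ((Set.finite_lt_nat N₀).union hU).subset ?_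
  rintro N ⟨r, hrC, hP, hnd⟩
  by_cases hN : N < N₀
  · exact Or.inl hN
  · refine Or.inr (Set.mem_biUnion (x := r) ?_ ?_)
    · exact ⟨hN₀ N (not_lt.mp hN) r hrC hP, hnd⟩
    · exact hP

/-- … hence the K-line residual `ThinFibreAt m₀` for EVERY `m₀` (tree glue `thinFibreAt_of_levelFinite`). -/
theorem thinFibreAt_of_descentCert {Q A : ℤ[X]} (𝒞 : DescentCert Q A) (m₀ : ℕ) : ThinFibreAt m₀ (dsP Q A) :=
  thinFibreAt_of_levelFinite (levelFinite_of_descentCert 𝒞) m₀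

end Summit.Schanuel.Schanuel.Theorems.RootDecomp1KDescent

end
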